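import Literature.Geometry.Symplectic.SurfaceRoundTube
import Mathlib.Geometry.Manifold.Instances.Sphere
import HarnessLib

/-!
# The model circle action on the tube of a symplectic surface

Topic `Literature/Geometry/Symplectic`; layer C3 of the construction of the symplectic tubular
neighbourhood with its `U(1)`-structure of a closed symplectic surface `b : S → N` in a
symplectic `4`-manifold (McLean, GAFA 2012, **Lemma 5.14**, `k = 1`: *"the structure group
`U(1)`"*), for the fact seat of
`Literature.Geometry.Symplectic.mclean_divisorComplement_convex_four`.

With the embedded tube domain `N₃`, the injective map `Θ = (π₁, nrm)` and its continuous inverse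
`Λ` (`SurfaceRoundTube.lean`), the rotations `planeTurn` of the normal planes
(`PlaneRotationOfTwoForm.lean`) transport to `N`:

* `Setup.turn y a` — the rotation of the normal plane `F y` by `a ∈ ℂ` (`turn_apply_of_mem`,
  `turn_turn`, `norm_turn`, `turn_Fr : turn a (Fr z) = Fr (a • z)`);
* **the model circle action** `Setup.rot a x = Λ (π₁ x, turn (π₁ x) a (nrm x))` on `N₃`:
  `Θ (rot a x) = (π₁ x, turn a (nrm x))` (`rot_spec`), group law (`rot_one`, `rot_mul`), the
  surface is fixed (`rot_b`), the action is free off the surface (`eq_one_of_rot_eq`), `ρ2` and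
  the round tubes are invariant (`ρ2_rot`, `rot_mem_T`), in every box chart it is the rotation
  of the fibre coordinate `(q, z) ↦ (q, a • z)` (`rot_eq_inv`), hence it is **smooth** on
  `S¹ × N₃` (`contMDiffOn_rot`);
* its **fundamental vector field** `Xm x = d/dt|₀ rot (exp t) x`: `dπ₁ (Xm x) = 0` and
  `d(nrm) (Xm x) = J (π₁ x) (nrm x)` (`dπ₁_Xm`, `dnrm_Xm`), so `Xm ≠ 0` off the surface.

Everything here is proved; no named facts (D-0026).

## References

* M. McLean, *The growth rate of symplectic homology and affine varieties*, GAFA 22 (2012),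
  Lemma 5.14, pp. 35–37 (arXiv:1011.2542). [Mclean2012]
* J. M. Lee, *Introduction to Smooth Manifolds*, 2nd ed. (2013), Ch. 20–21 (flows, group
  actions). [LeeSmoothManifolds2013]
-/

noncomputable section

open scoped Manifold ContDiff Topology RealInnerProductSpace
open Set Function Module Filter Metric
open Literature.Topology.FourManifolds
open Literature.Geometry.Kaehler
open Literature.Geometry.Manifold

namespace Literature.Geometry.Symplectic

/-- Local notation for the model plane. -/
local notation "E2" => EuclideanSpace ℝ (Fin 2)

/-! ### Complex multiplication on the coordinate plane -/

section RotC

/-- **Complex multiplication in real coordinates**: `rotC a z = (Re a z₀ - Im a z₁, Im a z₀ + Re a z₁)`.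
[folklore] -/
def rotC (a : ℂ) (z : E2) : E2 :=
  (a.re * z 0 - a.im * z 1) • EuclideanSpace.single 0 (1 : ℝ) +
    (a.im * z 0 + a.re * z 1) • EuclideanSpace.single 1 (1 : ℝ)

/-- The coordinates of `rotC a z`. [folklore] -/
theorem rotC_apply_zero (a : ℂ) (z : E2) : rotC a z 0 = a.re * z 0 - a.im * z 1 := by
  simp [rotC]

/-- The coordinates of `rotC a z`. [folklore] -/
theorem rotC_apply_one (a : ℂ) (z : E2) : rotC a z 1 = a.im * z 0 + a.re * z 1 := by
  simp [rotC]

/-- `rotC 1 = id`. [folklore] -/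
theorem rotC_one (z : E2) : rotC 1 z = z := by
  ext i
  fin_cases i <;> simp [rotC_apply_zero, rotC_apply_one]

/-- **Unit complex numbers act isometrically**: `‖rotC a z‖ = ‖z‖` for `|a| = 1`. [folklore] -/
theorem norm_rotC (a : Circle) (z : E2) : ‖rotC a z‖ = ‖z‖ := by
  have ha : (a : ℂ).re ^ 2 + (a : ℂ).im ^ 2 = 1 := by
    have h := Circle.normSq_coe a
    rw [Complex.normSq_apply] at h
    nlinarith [h]
  have h1 : ‖rotC a z‖ ^ 2 = ‖z‖ ^ 2 := by
    rw [EuclideanSpace.norm_sq_eq, EuclideanSpace.norm_sq_eq, Fin.sum_univ_two, Fin.sum_univ_two,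
      Real.norm_eq_abs, Real.norm_eq_abs, Real.norm_eq_abs, Real.norm_eq_abs, sq_abs, sq_abs,
      sq_abs, sq_abs, rotC_apply_zero, rotC_apply_one]
    nlinarith [ha]
  exact (sq_eq_sq₀ (norm_nonneg _) (norm_nonneg _)).1 h1

/-- `(a, z) ↦ rotC a z` is smooth. [folklore] -/
theorem contDiff_rotC : ContDiff ℝ ∞ (fun p : ℂ × E2 ↦ rotC p.1 p.2) := by
  unfold rotC
  have hre : ContDiff ℝ ∞ fun p : ℂ × E2 ↦ p.1.re := Complex.reCLM.contDiff.comp contDiff_fst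
  have him : ContDiff ℝ ∞ fun p : ℂ × E2 ↦ p.1.im := Complex.imCLM.contDiff.comp contDiff_fst
  have h0 : ContDiff ℝ ∞ fun p : ℂ × E2 ↦ p.2 0 :=
    (EuclideanSpace.proj (𝕜 := ℝ) (0 : Fin 2)).contDiff.comp contDiff_snd
  have h1 : ContDiff ℝ ∞ fun p : ℂ × E2 ↦ p.2 1 :=
    (EuclideanSpace.proj (𝕜 := ℝ) (1 : Fin 2)).contDiff.comp contDiff_snd
  exact (((hre.mul h0).sub (him.mul h1)).smul contDiff_const).add
    (((him.mul h0).add (hre.mul h1)).smul contDiff_const)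

end RotC

namespace SurfaceTube

variable {N : Type*} [TopologicalSpace N] [ChartedSpace (EuclideanSpace ℝ (Fin 4)) N]
  [IsManifold (𝓡 4) ∞ N] {S : Type*} [TopologicalSpace S] [ChartedSpace (EuclideanSpace ℝ (Fin 2)) S]
  [IsManifold (𝓡 2) ∞ S] {V : Type*} [NormedAddCommGroup V] [InnerProductSpace ℝ V]
  [FiniteDimensional ℝ V] (D : Setup N S V)

namespace Setup

/-! ### Rotations of the normal planes -/

/-- **The rotation of the normal plane `F y` by `a ∈ ℂ`** (identity on `(F y)ᗮ`):
`turn y a = planeTurn (Q y) (o y) a`. [cite: Mclean2012, Lemma 5.14] -/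
def turn (y : S) (a : ℂ) : V →L[ℝ] V := planeTurn (D.Q y) (D.o y) a

/-- `turn` in terms of the orthogonal projection onto `F y`. [folklore] -/
theorem turn_def (y : S) (a : ℂ) : D.turn y a = planeTurn (D.F y).starProjection (D.o y) a := rfl

/-- On the normal plane: `turn a v = Re a • v + Im a • J v`. [folklore] -/
theorem turn_apply_of_mem {y : S} (a : ℂ) {v : V} (hv : v ∈ D.F y) :
    D.turn y a v = a.re • v + a.im • D.J y v :=
  planeTurn_apply_of_mem a hv

/-- `turn 1 = id`. [folklore] -/
theorem turn_one_apply (y : S) (v : V) : D.turn y 1 v = v := planeTurn_one_apply _ _ v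

/-- **Group law**: `turn a (turn b v) = turn (a b) v`. [cite: Mclean2012, Lemma 5.14] -/
theorem turn_turn (y : S) (a b : ℂ) (v : V) : D.turn y a (D.turn y b v) = D.turn y (a * b) v :=
  planeTurn_planeTurn_apply (D.finrank_F y) (D.exists_o_ne_zero y) a b v

/-- `turn` preserves the normal plane. [folklore] -/
theorem turn_mem_F {y : S} (a : ℂ) {v : V} (hv : v ∈ D.F y) : D.turn y a v ∈ D.F y := by
  rw [D.turn_apply_of_mem a hv]
  exact (D.F y).add_mem ((D.F y).smul_mem _ hv) ((D.F y).smul_mem _ (D.J_apply_mem y v))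

/-- **Unit rotations are isometries.** [folklore] -/
theorem norm_turn (y : S) (a : Circle) (v : V) : ‖D.turn y a v‖ = ‖v‖ :=
  norm_planeTurn_of_normSq_eq_one (D.finrank_F y) (D.exists_o_ne_zero y) (Circle.normSq_coe a) v

/-- `turn a 0 = 0`. [folklore] -/
theorem turn_zero (y : S) (a : ℂ) : D.turn y a 0 = 0 := map_zero _

/-- The only unit rotation fixing a non-zero normal vector is `1`. [folklore] -/
theorem eq_one_of_turn_eq {y : S} {a : Circle} {v : V} (hv : D.Q y v ≠ 0)
    (h : D.turn y a v = v) : a = 1 :=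
  eq_one_of_planeTurn_apply_eq hv h

/-- **In a frame the rotation is complex multiplication**: `turn a (Fr z) = Fr (rotC a z)`.
[folklore] -/
theorem turn_Fr (c : V) (y : S) (a : ℂ) (z : E2) :
    D.turn y a (D.Fr c y z) = D.Fr c y (rotC a z) := by
  rw [D.turn_apply_of_mem a (D.Fr_mem_F c y z), D.J_Fr, D.Fr_apply, D.Fr_apply, rotC_apply_zero,
    rotC_apply_one]
  simp only [smul_add, smul_smul, sub_smul, add_smul, neg_smul, smul_neg]
  abel

/-! ### The model circle action -/

section Action

variable [CompactSpace S] [Nonempty S] [T2Space S]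

/-- **The model circle action** `rot a x = Λ (π₁ x, turn (π₁ x) a (nrm x))` (meaningful on
`N₃`): rotate the normal coordinate in its normal plane. [cite: Mclean2012, Lemma 5.14] -/
def rot (a : Circle) (x : N) : N := D.Λ (D.π₁ x, D.turn (D.π₁ x) a (D.nrm x))

/-- **Defining property of the action**: `rot a x ∈ N₃` and
`Θ (rot a x) = (π₁ x, turn a (nrm x))`. [folklore] -/
theorem rot_spec (a : Circle) {x : N} (hx : x ∈ D.N₃) :
    D.rot a x ∈ D.N₃ ∧ D.Θ (D.rot a x) = (D.π₁ x, D.turn (D.π₁ x) a (D.nrm x)) := by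
  obtain ⟨x', hx', h⟩ := D.exists_mem_N₃_Θ_eq_of_le hx (D.turn_mem_F (a : ℂ) (D.nrm_mem_F x))
    (D.norm_turn _ a _).le
  have hrot : D.rot a x = x' := by rw [rot, ← h, D.Λ_Θ hx']
  rw [hrot]
  exact ⟨hx', h⟩

/-- `rot a x ∈ N₃`. [folklore] -/
theorem rot_mem_N₃ (a : Circle) {x : N} (hx : x ∈ D.N₃) : D.rot a x ∈ D.N₃ := (D.rot_spec a hx).1

/-- `Θ (rot a x)`. [folklore] -/
theorem Θ_rot (a : Circle) {x : N} (hx : x ∈ D.N₃) :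
    D.Θ (D.rot a x) = (D.π₁ x, D.turn (D.π₁ x) a (D.nrm x)) := (D.rot_spec a hx).2

/-- The action preserves the feet: `π₁ (rot a x) = π₁ x`. [folklore] -/
theorem π₁_rot (a : Circle) {x : N} (hx : x ∈ D.N₃) : D.π₁ (D.rot a x) = D.π₁ x :=
  congrArg Prod.fst (D.Θ_rot a hx)

/-- The action rotates the normal coordinate: `nrm (rot a x) = turn a (nrm x)`. [folklore] -/
theorem nrm_rot (a : Circle) {x : N} (hx : x ∈ D.N₃) :
    D.nrm (D.rot a x) = D.turn (D.π₁ x) a (D.nrm x) :=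
  congrArg Prod.snd (D.Θ_rot a hx)

/-- **`rot 1 = id`.** [folklore] -/
theorem rot_one {x : N} (hx : x ∈ D.N₃) : D.rot 1 x = x := by
  refine D.injOn_Θ (D.N₃_subset_N₂ (D.rot_mem_N₃ 1 hx)) (D.N₃_subset_N₂ hx) ?_
  rw [D.Θ_rot 1 hx, Circle.coe_one, D.turn_one_apply, D.Θ_apply]

/-- **`rot a ∘ rot b = rot (a b)`.** [cite: Mclean2012, Lemma 5.14] -/
theorem rot_mul (a b : Circle) {x : N} (hx : x ∈ D.N₃) : D.rot a (D.rot b x) = D.rot (a * b) x := by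
  have hbx := D.rot_mem_N₃ b hx
  refine D.injOn_Θ (D.N₃_subset_N₂ (D.rot_mem_N₃ a hbx)) (D.N₃_subset_N₂ (D.rot_mem_N₃ _ hx)) ?_
  rw [D.Θ_rot a hbx, D.Θ_rot (a * b) hx, D.π₁_rot b hx, D.nrm_rot b hx, D.turn_turn, Circle.coe_mul]

/-- **The surface is fixed.** [folklore] -/
theorem rot_b (a : Circle) (y : S) : D.rot a (D.b y) = D.b y := by
  have hx := D.b_mem_N₃ y
  refine D.injOn_Θ (D.N₃_subset_N₂ (D.rot_mem_N₃ a hx)) (D.b_mem_N₂ y) ?_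
  rw [D.Θ_rot a hx, D.Θ_b, D.nrm_b, D.turn_zero, D.π₁_b]

/-- **`ρ2` is invariant.** [folklore] -/
theorem ρ2_rot (a : Circle) {x : N} (hx : x ∈ D.N₃) : D.ρ2 (D.rot a x) = D.ρ2 x := by
  rw [D.ρ2_apply, D.ρ2_apply, D.π₁_rot a hx, D.nrm_rot a hx, D.norm_turn]

/-- The round tubes are invariant. [folklore] -/
theorem rot_mem_T (a : Circle) {ε : ℝ} {x : N} (hx : x ∈ D.T ε) : D.rot a x ∈ D.T ε :=
  ⟨D.rot_mem_N₃ a hx.1, by rw [D.ρ2_rot a hx.1]; exact hx.2⟩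

/-- The punctured round tubes are invariant. [folklore] -/
theorem rot_mem_T_diff (a : Circle) {ε : ℝ} {x : N} (hx : x ∈ D.T ε \ range D.b) :
    D.rot a x ∈ D.T ε \ range D.b := by
  refine ⟨D.rot_mem_T a hx.1, fun hB ↦ hx.2 ?_⟩
  rw [← D.ρ2_eq_zero_iff (D.N₃_subset_N₂ hx.1.1), ← D.ρ2_rot a hx.1.1]
  exact (D.ρ2_eq_zero_iff (D.N₃_subset_N₂ (D.rot_mem_N₃ a hx.1.1))).2 hB

/-- **The action is free off the surface.** [cite: Mclean2012, Lemma 5.14] -/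
theorem eq_one_of_rot_eq {a : Circle} {x : N} (hx : x ∈ D.N₃) (hxB : x ∉ range D.b)
    (h : D.rot a x = x) : a = 1 := by
  have hn : D.turn (D.π₁ x) a (D.nrm x) = D.nrm x := by
    have := D.nrm_rot a hx
    rw [h] at this
    exact this.symm
  refine D.eq_one_of_turn_eq ?_ hn
  rw [D.Q_nrm]
  intro h0
  apply hxB
  rw [← D.ρ2_eq_zero_iff (D.N₃_subset_N₂ hx), D.ρ2_apply, h0, norm_zero, zero_pow two_ne_zero, mul_zero]

/-! ### The action in the box charts; smoothness -/

/-- **In a box chart the action is the rotation of the fibre coordinate**: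
`rot a x = inv (q, rotC a z)` for `Ξ x = (q, z)` (for `x ∈ N₃` in the chart domain), and
`(q, rotC a z)` lies in the box. [folklore] -/
theorem rot_eq_inv {y₀ : S} (B : D.BoxChart y₀) {x : N} (hx3 : x ∈ D.N₃) (hx : x ∈ B.O)
    (a : Circle) :
    ((D.Ξ y₀ B.c x).1, rotC a (D.Ξ y₀ B.c x).2) ∈ B.box ∧
      D.rot a x = B.inv ((D.Ξ y₀ B.c x).1, rotC a (D.Ξ y₀ B.c x).2) := by
  have hbox := B.Ξ_mem_box hx
  have hp : ((D.Ξ y₀ B.c x).1, rotC a (D.Ξ y₀ B.c x).2) ∈ B.box :=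
    ⟨hbox.1, by rw [mem_ball_zero_iff, norm_rotC]; exact mem_ball_zero_iff.1 hbox.2⟩
  refine ⟨hp, D.injOn_Θ (D.N₃_subset_N₂ (D.rot_mem_N₃ a hx3)) (B.O_subset_N₂ (B.inv_mem_O hp)) ?_⟩
  rw [D.Θ_rot a hx3, B.Θ_inv hp]
  -- compare with `Θ x = Θ (inv (Ξ x))`
  have hΘx : D.Θ x = ((extChartAt (𝓡 2) y₀).symm (D.Ξ y₀ B.c x).1,
      D.Fr B.c ((extChartAt (𝓡 2) y₀).symm (D.Ξ y₀ B.c x).1) (D.Ξ y₀ B.c x).2) := by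
    conv_lhs => rw [← B.inv_Ξ x hx]
    exact B.Θ_inv hbox
  have h1 : D.π₁ x = (extChartAt (𝓡 2) y₀).symm (D.Ξ y₀ B.c x).1 := congrArg Prod.fst hΘx
  have h2 : D.nrm x = D.Fr B.c ((extChartAt (𝓡 2) y₀).symm (D.Ξ y₀ B.c x).1) (D.Ξ y₀ B.c x).2 :=
    congrArg Prod.snd hΘx
  show (D.π₁ x, D.turn (D.π₁ x) a (D.nrm x)) = _
  rw [h2, ← h1, D.turn_Fr]

/-- The chart domains of box charts inside `N₃` are invariant. [folklore] -/
theorem rot_mem_O {y₀ : S} (B : D.BoxChart y₀) {x : N} (hx3 : x ∈ D.N₃) (hx : x ∈ B.O)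
    (a : Circle) : D.rot a x ∈ B.O := by
  rw [(D.rot_eq_inv B hx3 hx a).2]
  exact B.inv_mem_O (D.rot_eq_inv B hx3 hx a).1

/-- **The model circle action is smooth on `S¹ × N₃`.** [cite: Mclean2012, Lemma 5.14] -/
theorem contMDiffOn_rot :
    ContMDiffOn ((𝓡 1).prod (𝓡 4)) (𝓡 4) ∞ (fun p : Circle × N ↦ D.rot p.1 p.2) (univ ×ˢ D.N₃) := by
  rintro ⟨a, x⟩ ⟨-, hx⟩
  obtain ⟨i, hi⟩ := D.mem_N₃_iff.1 hx
  set B := D.atlas.chart i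
  have hO3 : B.O ⊆ D.N₃ := fun x hx ↦ D.mem_N₃_iff.2 ⟨i, hx⟩
  -- the chart formula on `univ ×ˢ Oᵢ`
  have heq : EqOn (fun p : Circle × N ↦ D.rot p.1 p.2)
      (fun p ↦ B.inv ((D.Ξ (D.atlas.yc i) B.c p.2).1, rotC p.1 (D.Ξ (D.atlas.yc i) B.c p.2).2))
      (univ ×ˢ B.O) := by
    rintro ⟨a', x'⟩ ⟨-, hx'⟩
    exact (D.rot_eq_inv B (hO3 hx') hx' a').2
  have hg : ContMDiffOn ((𝓡 1).prod (𝓡 4)) 𝓘(ℝ, E2 × E2) ∞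
      (fun p : Circle × N ↦ ((D.Ξ (D.atlas.yc i) B.c p.2).1, rotC p.1 (D.Ξ (D.atlas.yc i) B.c p.2).2))
      (univ ×ˢ B.O) := by
    have hΞ : ContMDiffOn ((𝓡 1).prod (𝓡 4)) 𝓘(ℝ, E2 × E2) ∞
        (fun p : Circle × N ↦ D.Ξ (D.atlas.yc i) B.c p.2) (univ ×ˢ B.O) :=
      B.contMDiffOn_Ξ.comp contMDiffOn_snd fun p hp ↦ hp.2
    haveI : Fact (Module.finrank ℝ ℂ = 1 + 1) := finrank_real_complex_fact'
    have hc : ContMDiff (𝓡 1) 𝓘(ℝ, ℂ) ∞ (fun z : Circle ↦ (z : ℂ)) := contMDiff_coe_sphere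
    have hpair : ContMDiffOn ((𝓡 1).prod (𝓡 4)) 𝓘(ℝ, ℂ × E2) ∞
        (fun p : Circle × N ↦ ((p.1 : ℂ), (D.Ξ (D.atlas.yc i) B.c p.2).2)) (univ ×ˢ B.O) :=
      (hc.comp_contMDiffOn contMDiffOn_fst).prodMk_space
        ((contDiff_snd (𝕜 := ℝ) (E := E2) (F := E2)).contMDiff.comp_contMDiffOn hΞ)
    exact ((contDiff_fst (𝕜 := ℝ) (E := E2) (F := E2)).contMDiff.comp_contMDiffOn hΞ).prodMk_space
      (contDiff_rotC.contMDiff.comp_contMDiffOn hpair)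
  have hmaps : MapsTo
      (fun p : Circle × N ↦ ((D.Ξ (D.atlas.yc i) B.c p.2).1, rotC p.1 (D.Ξ (D.atlas.yc i) B.c p.2).2))
      (univ ×ˢ B.O) B.box := by
    rintro ⟨a', x'⟩ ⟨-, hx'⟩
    exact (D.rot_eq_inv B (hO3 hx') hx' a').1
  have hcont : ContMDiffOn ((𝓡 1).prod (𝓡 4)) (𝓡 4) ∞ (fun p : Circle × N ↦ D.rot p.1 p.2)
      (univ ×ˢ B.O) :=
    (B.contMDiffOn_inv.comp hg hmaps).congr heq
  exact (hcont _ ⟨mem_univ _, hi⟩).mono_of_mem_nhdsWithin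
    (mem_nhdsWithin_of_mem_nhds ((isOpen_univ.prod B.isOpen_O).mem_nhds ⟨mem_univ _, hi⟩))

/-- Each `rot a` is smooth on `N₃`. [folklore] -/
theorem contMDiffOn_rot_left (a : Circle) : ContMDiffOn (𝓡 4) (𝓡 4) ∞ (D.rot a) D.N₃ :=
  D.contMDiffOn_rot.comp (contMDiffOn_const.prodMk contMDiffOn_id) fun _ hx ↦ ⟨mem_univ _, hx⟩

/-- `rot a` is continuous on `N₃`. [folklore] -/
theorem continuousOn_rot_left (a : Circle) : ContinuousOn (D.rot a) D.N₃ :=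
  (D.contMDiffOn_rot_left a).continuousOn

/-! ### The orbits and the fundamental vector field -/

/-- The orbit curves `t ↦ rot (exp t) x` are smooth (`x ∈ N₃`). [folklore] -/
theorem contMDiff_orbit {x : N} (hx : x ∈ D.N₃) :
    ContMDiff 𝓘(ℝ, ℝ) (𝓡 4) ∞ (fun t : ℝ ↦ D.rot (Circle.exp t) x) :=
  D.contMDiffOn_rot.comp_contMDiff ((contMDiff_circleExp (m := ∞)).prodMk contMDiff_const)
    fun _ ↦ ⟨mem_univ _, hx⟩

/-- Along an orbit the foot is constant. [folklore] -/
theorem π₁_orbit {x : N} (hx : x ∈ D.N₃) (t : ℝ) : D.π₁ (D.rot (Circle.exp t) x) = D.π₁ x :=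
  D.π₁_rot _ hx

/-- **Along an orbit the normal coordinate turns**: `nrm (rot (exp t) x) = cos t • n + sin t • J n`.
[folklore] -/
theorem nrm_orbit {x : N} (hx : x ∈ D.N₃) (t : ℝ) :
    D.nrm (D.rot (Circle.exp t) x) = Real.cos t • D.nrm x + Real.sin t • D.J (D.π₁ x) (D.nrm x) := by
  rw [D.nrm_rot _ hx, D.turn_apply_of_mem _ (D.nrm_mem_F x), Circle.coe_exp,
    Complex.exp_ofReal_mul_I_re, Complex.exp_ofReal_mul_I_im]

/-- **The fundamental vector field of the model action**: `Xm x = d/dt|₀ rot (exp t) x`.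
[cite: Mclean2012, Lemma 5.14] -/
def Xm (x : N) : TangentSpace (𝓡 4) x :=
  mfderiv 𝓘(ℝ, ℝ) (𝓡 4) (fun t : ℝ ↦ D.rot (Circle.exp t) x) 0 (1 : ℝ)

/-- The orbit starts at `x`. [folklore] -/
theorem rot_exp_zero {x : N} (hx : x ∈ D.N₃) : D.rot (Circle.exp 0) x = x := by
  rw [Circle.exp_zero, D.rot_one hx]

/-- **`dπ₁ (Xm) = 0`**: the fundamental field is vertical. [folklore] -/
theorem dπ₁_Xm {x : N} (hx : x ∈ D.N₃) : D.dπ₁ x (D.Xm x) = 0 := by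
  have h0 := D.rot_exp_zero hx
  have hγ : HasMFDerivAt 𝓘(ℝ, ℝ) (𝓡 4) (fun t : ℝ ↦ D.rot (Circle.exp t) x) 0
      (mfderiv 𝓘(ℝ, ℝ) (𝓡 4) (fun t : ℝ ↦ D.rot (Circle.exp t) x) 0) :=
    ((D.contMDiff_orbit hx).mdifferentiableAt (by simp)).hasMFDerivAt
  have hπ : HasMFDerivAt (𝓡 4) (𝓡 2) D.π₁ (D.rot (Circle.exp 0) x)
      (mfderiv (𝓡 4) (𝓡 2) D.π₁ (D.rot (Circle.exp 0) x)) :=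
    (D.mdifferentiableAt_π₁ (D.N₃_subset_N₁ (by rw [h0]; exact hx))).hasMFDerivAt
  have hcomp := hπ.comp 0 hγ
  have hconst : HasMFDerivAt 𝓘(ℝ, ℝ) (𝓡 2) (D.π₁ ∘ fun t : ℝ ↦ D.rot (Circle.exp t) x) 0
      (0 : TangentSpace 𝓘(ℝ, ℝ) (0 : ℝ) →L[ℝ] TangentSpace (𝓡 2) (D.π₁ (D.rot (Circle.exp 0) x))) := by
    have h : (D.π₁ ∘ fun t : ℝ ↦ D.rot (Circle.exp t) x) = fun _ ↦ D.π₁ x := by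
      funext t; exact D.π₁_orbit hx t
    rw [h]
    exact hasMFDerivAt_const _ _
  have heq := hcomp.mfderiv.symm.trans hconst.mfderiv
  have happ := congrArg (fun L : TangentSpace 𝓘(ℝ, ℝ) (0 : ℝ) →L[ℝ]
      TangentSpace (𝓡 2) (D.π₁ (D.rot (Circle.exp 0) x)) ↦ L (1 : ℝ)) heq
  rw [ContinuousLinearMap.comp_apply] at happ
  rw [h0] at happ
  exact happ

/-- **`d(nrm) (Xm) = J (nrm)`**: the fundamental field turns the normal coordinate. [folklore] -/
theorem dnrm_Xm {x : N} (hx : x ∈ D.N₃) : D.dnrm x (D.Xm x) = D.J (D.π₁ x) (D.nrm x) := by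
  have h0 := D.rot_exp_zero hx
  have hγ : MDifferentiableAt 𝓘(ℝ, ℝ) (𝓡 4) (fun t : ℝ ↦ D.rot (Circle.exp t) x) 0 :=
    (D.contMDiff_orbit hx).mdifferentiableAt (by simp)
  have hn : MDifferentiableAt (𝓡 4) 𝓘(ℝ, V) D.nrm (D.rot (Circle.exp 0) x) :=
    D.mdifferentiableAt_nrm (D.N₃_subset_N₁ (by rw [h0]; exact hx))
  have hchain := mfderiv_comp 0 hn hγ
  -- as an honest curve in `V`: derivative of `t ↦ cos t • n + sin t • J n` at `0`
  have hcurve : (D.nrm ∘ fun t : ℝ ↦ D.rot (Circle.exp t) x) =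
      fun t ↦ Real.cos t • D.nrm x + Real.sin t • D.J (D.π₁ x) (D.nrm x) := by
    funext t; exact D.nrm_orbit hx t
  have hd : HasDerivAt (fun t ↦ Real.cos t • D.nrm x + Real.sin t • D.J (D.π₁ x) (D.nrm x))
      (D.J (D.π₁ x) (D.nrm x)) 0 := by
    have h := ((Real.hasDerivAt_cos 0).smul_const (D.nrm x)).add
      ((Real.hasDerivAt_sin 0).smul_const (D.J (D.π₁ x) (D.nrm x)))
    rw [Real.sin_zero, Real.cos_zero, neg_zero, zero_smul, zero_add, one_smul] at h
    exact h
  have hder : deriv (fun t ↦ Real.cos t • D.nrm x + Real.sin t • D.J (D.π₁ x) (D.nrm x)) 0 =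
      D.J (D.π₁ x) (D.nrm x) := hd.deriv
  have happ := congrArg (fun L : TangentSpace 𝓘(ℝ, ℝ) (0 : ℝ) →L[ℝ]
      TangentSpace 𝓘(ℝ, V) (D.nrm (D.rot (Circle.exp 0) x)) ↦ L (1 : ℝ)) hchain
  rw [ContinuousLinearMap.comp_apply, hcurve, mfderiv_eq_fderiv] at happ
  rw [h0] at happ
  exact happ.symm.trans hder

/-- **The fundamental field does not vanish off the surface.** [cite: Mclean2012, Lemma 5.14] -/
theorem Xm_ne_zero {x : N} (hx : x ∈ D.N₃) (hxB : x ∉ range D.b) : D.Xm x ≠ 0 := by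
  intro h
  have h1 := D.dnrm_Xm hx
  rw [h, map_zero] at h1
  have hn : D.nrm x = 0 := by
    have h2 : D.Q (D.π₁ x) (D.nrm x) = 0 := by
      rw [← neg_eq_zero, ← D.J_J_apply, ← h1, map_zero]
    rwa [D.Q_nrm] at h2
  apply hxB
  rw [← D.ρ2_eq_zero_iff (D.N₃_subset_N₂ hx), D.ρ2_apply, hn, norm_zero, zero_pow two_ne_zero,
    mul_zero]

end Action

end Setup

end SurfaceTube

end Literature.Geometry.Symplectic
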